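import Summits.HodgeConjecture.HodgeConjecture.Theorems.F0P6aSiegelCarrierReciprocity
import Literature.AlgebraicGeometry.ShimuraVarieties.UnitaryCurveSpecialPairReciprocityCentralTwist
import Literature.AlgebraicGeometry.ShimuraVarieties.UnitaryCurveSpecialPairOfAuxComplexStructure
import HarnessLib

/-!
# The Galois action on the chart's special points for `σ ∈ Aut(ℂ/ι₁F)` — reciprocity with the CENTRAL TORUS FACTOR, read through the point map
# (organ (S2a) of the sheet line `stub_ESHEET`, Summits-side glue over ★ E3R-S)

Summit `HodgeConjecture`, sub-problem `HodgeConjecture`, crux `stmt-HodgeConjecture-24832` (HLiu418), sub-line P6a, X-leaf `stub_ESHEET` («the sheet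
line», E-pen A-p01 (g28) memo `MEMO-ESHEET-organs.v1` 66df4d8c), organ (S2a), LA4-plan (g0) DEAL #26 → LA6-p02 (g2).  Cell `hodgecm-mathlib`
(D-0151); HONEST LABEL: HC_CM is proved only modulo the 2 remaining named inputs (hLiu418 24832, h413 24833) until rung 0 closes; this file is a
`--supports 24832` helper and changes no count.  THEOREMS ONLY; imports ★ Theorems ∕ ★ Literature only.

WHY.  The E-line chart's `f_recip`∕`cm_recip` (`AuxChartGS`, ED. 5) give the Galois action on the image `f[ι₁w, a]` of a special point only for
`σ ∈ Aut(ℂ∕Fᵢ)` — over the slice field the central torus coordinate `t = N_{E♯,Φ}(s♯)` of the Siegel reciprocity element `r = ũ_V(d♯, t)` dies in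
`K_δ(N)`.  The sheet line compares the `τE∘γ`-sheet with the Serre-tensored family and needs the action of `γ̃ ∈ Aut(ℂ∕ι₁F)` NOT fixing `Fᵢ`:
there `ũ_V(1, t)` survives as the CENTRAL TWIST.  ★ `UnitaryCurve.AuxV.exists_siegelRecipDatum_centralTwist(_of_isGalois)` (Literature, (S2a)) supplies
the datum with `t` exported; this file reads it through ANY point map with the shadow formula (§1, chart-generic, = ★ `smul_f_mk_eq_of_cmDatum` with
the GROUP identity `r·b(a) = b(d♯a)·z` in place of the class identity) and packages the one-call form for the concrete E3 chart (§2: E1's frame `Fr`,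
E2's `J = auxComplexStructureV Fr ι₁ Φ`, `b = ũ_V(·,1)`, ★ `isSpecial_auxComplexStructureV_curve`), for `F∕ℚ` Galois and every `σ` fixing `ι₁(F)`:
**`σ • f [ι₁w, a] = bc⁻¹ pts⁻¹ [J_Φ(ι₁w), ũ_V(d♯·a, 1) · ũ_V(1, t)]`** together with the datum (`c` special + pinned, `t = N_{E♯,Φ}(s♯)`, the type-norm
identity for `Ψ`, `[ι₁w, d·a]_K = [ι₁w, d♯·a]_K`).
[cite: Milne2005ShimuraVarieties, Def. 12.8 (62) p. 114, Prop. 14.12 p. 125] [cite: Deligne1971TravauxShimura, 5.11 p. 158, Thm. 4.21 p. 152]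
[cite: Shimura1998, §18.6 p. 128] [cite: RapoportSmithlingZhang2020Diagonal, Remark 3.1 p. 9, (3.3), (3.10)]
-/

set_option autoImplicit false

noncomputable section

-- the mandated namespace has the single-problem summit's repeated segment (`HodgeConjecture.HodgeConjecture`)
set_option linter.dupNamespace false

namespace Summit.HodgeConjecture.HodgeConjecture.Theorems.F0P6aSpecialPairRecipCentralTwistOfChart

open CategoryTheory AlgebraicGeometry Matrix NumberField IsDedekindDomain
open Literature.AlgebraicGeometry.ModuliOfAbelianVarieties
open Literature.AlgebraicGeometry.ModuliOfAbelianVarieties.SiegelModuli (jOfSiegel jOfSiegel_mem_C0)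
open Literature.AlgebraicGeometry.Motives (SchemeOver ComplexPoints AlgPoints specOver CMType)
open Literature.AlgebraicGeometry.AbelianSchemes (PolarizedAbelianSchemeWithLevel)
open Literature.NumberTheory.Automorphic Literature.NumberTheory.Automorphic.UnitaryGroup
open Literature.NumberTheory.ComplexMultiplication (traceField reflexNormFiniteIdele ratFiniteAdeleTensorEquiv)
open Literature.AlgebraicGeometry.ShimuraVarieties
open Literature.AlgebraicGeometry.ShimuraVarieties.UnitaryCanonicalModel (IsArtinCorrespondent recipFactor IsDiagTwistGS ShimuraSetGS)
open Literature.AlgebraicGeometry.ShimuraVarieties.UnitaryCanonicalModel.Aux (torusFinAdelic reflexField numberField_reflexField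
  finAdeleToTensor ratBasis)
open Literature.AlgebraicGeometry.ShimuraVarieties.UnitaryCurve.AuxV
open Summit.HodgeConjecture.HodgeConjecture.Theorems.F0P6aSiegelCarrierReciprocity (smul_q_mk_eq_q_mk_cmRecip_of_forall_mem_apply_eq)

/-! ### §1 E3R-S glue, chart-generic: the CM datum with a GROUP identity `r·b(a) = b(a′)·z` gives `σ • f[ι₁w, a] = bc⁻¹pts⁻¹[J(ι₁w), b(a′)·z]` -/

/-- **THE GALOIS ACTION ON `f` AT A SPECIAL POINT, WITH AN EXPLICIT TRANSLATE** (E3R-S glue, chart-generic): Siegel carrier data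
`(𝓜, Sc, ιc, unif, u, rep, pts)` with A4's clauses and (U3-D3) as in ★ `smul_q_mk_eq_q_mk_cmRecip_of_forall_mem_apply_eq`; a curve datum `(F, ι₁, J⋆)`;
ANY Hodge-embedding datum `J` with `J v ∈ S^±`, ANY map `b : U(J⋆)(𝔸_f) → GSp_δ(𝔸_f)`, ANY point map `f` at level `K` with the shadow formula
`pts (f [v, aK]) = [J v, b a]_{K_δ(N)}`.  If at `(σ, w, a)` the CM datum holds — `(c, J(ι₁w))` special of types `Φ′`, `E*(Φ′ᵢ) ⊆ E`, `σ` fixes `E`,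
`s♯` an Artin correspondent of `σ` over `E`, `r` of matrix `c.cmRecipMatrix Φ′ E s♯` — and `r · b a = b a′ · z` in `GSp_δ(𝔸_f)`, then
`σ • f [ι₁w, aK] = bc⁻¹ (pts⁻¹ [J(ι₁w), b a′ · z]_{K_δ(N)})`.  (★ `smul_f_mk_eq_of_cmDatum` is the case `z ∈ K_δ(N)`, `a′ = d♯·a`.)
[cite: Milne2005ShimuraVarieties, Def. 12.8 (62) p. 114 and Prop. 14.12 p. 125] [cite: Deligne1971TravauxShimura, Thm. 4.21 p. 152] -/
theorem smul_f_mk_eq_symm_mk_of_cmDatum {g N : ℕ} {δ : Fin g → ℕ} (hg : 0 < g) (hδ : IsPolarizationType δ) (hN : 3 ≤ N)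
    (𝓜 : SiegelFineModuliScheme g N δ)
    {Sc : (ZMod N)ˣ → SchemeOver ℂ} (ιc : ∀ c, Sc c ⟶ (Literature.AlgebraicGeometry.Motives.baseChange ℚ ℂ).obj 𝓜.M)
    (unif : ∀ _c : (ZMod N)ˣ, Matrix (Fin g) (Fin g) ℂ → ComplexPoints (Sc _c))
    {u : (ZMod N)ˣ → finAdeleQˣ} {rep : (ZMod N)ˣ → ↥(gspFinAdelic δ)}
    (hu : ∀ c w, Valued.v ((u c : finAdeleQ) w) = 1)
    (huc : ∀ c, (u c : finAdeleQ) - ((c : ZMod N).val : ℕ) ∈ levelIdeal N)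
    (hmult : ∀ c, IsMultiplier (typeFormOver δ finAdeleQ) (rep c : GL (Fin g ⊕ Fin g) finAdeleQ) (u c))
    (hD3 : haveI : IsLocallyNoetherian (specOver ℚ ℂ).left := inferInstanceAs (IsLocallyNoetherian (Spec (CommRingCat.of ℂ)))
      ∀ (c : (ZMod N)ˣ) (Z : Matrix (Fin g) (Fin g) ℂ) (hZ : Z ∈ siegelUpperHalfSpace g)
        (P' : PolarizedAbelianSchemeWithLevel g N δ (specOver ℚ ℂ).left), IsAdmissibleAt hδ (rep c) Z hZ P' →
          AlgPoints.map (ιc c) (unif c Z) =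
            AlgPoints.baseChangeEquiv (algebraMap ℚ ℂ) 𝓜.M (𝓜.classifyingMap (specOver ℚ ℂ) P'))
    (pts : ComplexPoints ((Literature.AlgebraicGeometry.Motives.baseChange ℚ ℂ).obj 𝓜.M) ≃
      SiegelShimuraSet δ (principalLevelSubgroup δ N))
    (hval : ∀ (c : (ZMod N)ˣ) (W : Matrix (Fin g) (Fin g) ℂ) (hW : W ∈ siegelUpperHalfSpace g),
      pts (AlgPoints.map (ιc c) (unif c W)) =
        SiegelShimuraSet.mk δ (principalLevelSubgroup δ N)
          ⟨jOfSiegel δ W, C0_subset_C0pm δ (jOfSiegel_mem_C0 hδ.1 hW)⟩ (rep c))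
    -- the curve datum, ANY Hodge-embedding datum, ANY group map, ANY point map with the shadow formula
    {F : Type} [Field F] [NumberField F] [IsCMField F] (ι₁ : F →+* ℂ) (Jstar : Matrix (Fin 2) (Fin 2) F)
    (J : (Fin 2 → ℂ) → Matrix (Fin g ⊕ Fin g) (Fin g ⊕ Fin g) ℝ)
    (hJC : ∀ v : Fin 2 → ℂ, v ∈ negCone (Jstar.map ι₁) → J v ∈ C0pm δ)
    (K : Subgroup ↥(finAdelic (↥(maximalRealSubfield F)) F (IsCMField.complexConj F) 2 Jstar))
    (b : ↥(finAdelic (↥(maximalRealSubfield F)) F (IsCMField.complexConj F) 2 Jstar) → ↥(gspFinAdelic δ))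
    (f : ShimuraSetGS F Jstar ι₁ K → ComplexPoints 𝓜.M)
    (hf : ∀ (v : Fin 2 → ℂ) (hv : v ∈ negCone (Jstar.map ι₁)) (a : ↥(finAdelic (↥(maximalRealSubfield F)) F (IsCMField.complexConj F) 2 Jstar)),
      pts (AlgPoints.baseChangeEquiv (algebraMap ℚ ℂ) 𝓜.M (f (ShimuraSetGS.mk F Jstar ι₁ K v hv a))) =
        SiegelShimuraSet.mk δ (principalLevelSubgroup δ N) ⟨J v, hJC v hv⟩ (b a))
    -- the point `(σ, w, a)` and the CM datum there
    (σ : ℂ ≃ₐ[ℚ] ℂ) (w : Fin 2 → F) (hw : (fun i => ι₁ (w i)) ∈ negCone (Jstar.map ι₁))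
    (a a' : ↥(finAdelic (↥(maximalRealSubfield F)) F (IsCMField.complexConj F) 2 Jstar))
    (E : IntermediateField ℚ ℂ) [NumberField ↥E] (c : CMStructure g δ (Fin 2) (fun _ => F)) (Φ' : Fin 2 → CMType F)
    (sE : (FiniteAdeleRing (𝓞 ↥E) ↥E)ˣ) (r z : ↥(gspFinAdelic δ))
    (hsp : c.IsSpecial ⟨J (fun i => ι₁ (w i)), hJC _ hw⟩ Φ') (hE : ∀ i, traceField (Φ' i) ≤ E) (hσ : ∀ x : ℂ, x ∈ E → σ x = x)
    (hsE : IsArtinCorrespondent ↥E (algebraMap ↥E ℂ) sE σ.toRingEquiv)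
    (hr : ((r : GL (Fin g ⊕ Fin g) finAdeleQ) : Matrix (Fin g ⊕ Fin g) (Fin g ⊕ Fin g) finAdeleQ) = c.cmRecipMatrix Φ' E sE)
    (hS : r * b a = b a' * z) :
    σ • f (ShimuraSetGS.mk F Jstar ι₁ K (fun i => ι₁ (w i)) hw a) =
      (AlgPoints.baseChangeEquiv (algebraMap ℚ ℂ) 𝓜.M).symm
        (pts.symm (SiegelShimuraSet.mk δ (principalLevelSubgroup δ N) ⟨J (fun i => ι₁ (w i)), hJC _ hw⟩ (b a' * z))) := by
  classical
  -- E3R-S at the special pair `(c, J(ι₁ w), Φ′)` and the class `[J(ι₁w), b a]`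
  have hSrec := smul_q_mk_eq_q_mk_cmRecip_of_forall_mem_apply_eq hg hδ hN 𝓜 ιc unif hu huc hmult hD3 pts hval (Fin 2) (fun _ => F) c
    ⟨J (fun i => ι₁ (w i)), hJC _ hw⟩ Φ' hsp E hE σ hσ sE hsE r hr (b a)
  -- read the left side through `f` by the shadow formula
  have h1 : (AlgPoints.baseChangeEquiv (algebraMap ℚ ℂ) 𝓜.M) (f (ShimuraSetGS.mk F Jstar ι₁ K (fun i => ι₁ (w i)) hw a)) =
      pts.symm (SiegelShimuraSet.mk δ (principalLevelSubgroup δ N) ⟨J (fun i => ι₁ (w i)), hJC _ hw⟩ (b a)) :=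
    (Equiv.eq_symm_apply pts).2 (hf _ hw a)
  have hread : f (ShimuraSetGS.mk F Jstar ι₁ K (fun i => ι₁ (w i)) hw a) =
      (AlgPoints.baseChangeEquiv (algebraMap ℚ ℂ) 𝓜.M).symm (pts.symm (SiegelShimuraSet.mk δ (principalLevelSubgroup δ N)
        ⟨J (fun i => ι₁ (w i)), hJC _ hw⟩ (b a))) :=
    (Equiv.eq_symm_apply (AlgPoints.baseChangeEquiv (algebraMap ℚ ℂ) 𝓜.M)).2 h1
  rw [hread, hSrec, hS]

/-! ### §2 The concrete E3 chart, `F/ℚ` Galois: every `σ ∈ Aut(ℂ/ι₁F)` — one call -/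

/-- **(S2a) FOR THE E-LINE CHART: THE ACTION OF `σ ∈ Aut(ℂ/ι₁F)` ON `f[ι₁w, a]` IS THE `ũ_V(1, t)`-TRANSLATE OF `f`'s SHADOW AT `d♯·a`, `t = N_{E♯,Φ}(s♯)`.**
For the concrete chart data of `stub_E123` (E1's frame `Fr`, E2's `J_Φ = auxComplexStructureV Fr ι₁ Φ`, `b = ũ_V(·,1)`, ANY point map `f` at ANY level
`K` with the shadow formula), `F/ℚ` GALOIS: for every `σ : ℂ ≃ₐ[ℚ] ℂ` with `σ ∘ ι₁ = ι₁`, every `F`-correspondent `s`, special `w`, twist `d` and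
adelic `a` — the datum `(c, Φ′, s♯, t, d♯)` of ★ `exists_siegelRecipDatum_centralTwist_of_isGalois` (special + pinned `c`, `Φ′ = (Φ, Ψ)`, `E*(Φ′ᵢ) ⊆ E♯`
FIXED by `σ`, `s♯ ↔ σ` over `E♯`, `ũ_V(d♯,t)` of matrix `c.cmRecipMatrix Φ′ E♯ s♯`, `t = N_{E♯,Φ}(s♯)`, the `F`-correspondent `s′` with `d♯ = r_w(s′)`-twist
and `N_{E♯,Ψ}(s♯) = t·(s̄′/s′)`, `[ι₁w, d·a]_{K′} = [ι₁w, d♯·a]_{K′}`) AND the point equation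
**`σ • f [ι₁w, a] = bc⁻¹ (pts⁻¹ [J_Φ(ι₁w), ũ_V(d♯·a, 1) · ũ_V(1, t)]_{K_δ(N)})`** (§1 over the split identity).  For `σ ∈ Aut(ℂ∕Fᵢ)` over the slice
field this is `C.f_recip`∕`C.cm_recip` (★ `exists_sliceField_f_recip_cmDatum_pinned`, `ũ_V(1,t) ∈ K_δ(N)`); here `ũ_V(1,t)` is the central twist.
[cite: Milne2005ShimuraVarieties, Def. 12.8 (59)–(62) p. 114 and Prop. 14.12 p. 125] [cite: Deligne1971TravauxShimura, 4.18 p. 150, 5.11 p. 158 and Thm. 4.21 p. 152]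
[cite: Shimura1998, §8.3 Prop. 28 and §18.6 p. 128] [cite: RapoportSmithlingZhang2020Diagonal, Remark 3.1 p. 9 and (3.10)] -/
theorem exists_cmDatum_smul_f_mk_eq_centralTwist_of_isGalois {g N : ℕ} {δ : Fin g → ℕ} (hg : 0 < g) (hδ : IsPolarizationType δ)
    (hN : 3 ≤ N) (𝓜 : SiegelFineModuliScheme g N δ)
    {Sc : (ZMod N)ˣ → SchemeOver ℂ} (ιc : ∀ c, Sc c ⟶ (Literature.AlgebraicGeometry.Motives.baseChange ℚ ℂ).obj 𝓜.M)
    (unif : ∀ _c : (ZMod N)ˣ, Matrix (Fin g) (Fin g) ℂ → ComplexPoints (Sc _c))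
    {u : (ZMod N)ˣ → finAdeleQˣ} {rep : (ZMod N)ˣ → ↥(gspFinAdelic δ)}
    (hu : ∀ c w, Valued.v ((u c : finAdeleQ) w) = 1)
    (huc : ∀ c, (u c : finAdeleQ) - ((c : ZMod N).val : ℕ) ∈ levelIdeal N)
    (hmult : ∀ c, IsMultiplier (typeFormOver δ finAdeleQ) (rep c : GL (Fin g ⊕ Fin g) finAdeleQ) (u c))
    (hD3 : haveI : IsLocallyNoetherian (specOver ℚ ℂ).left := inferInstanceAs (IsLocallyNoetherian (Spec (CommRingCat.of ℂ)))
      ∀ (c : (ZMod N)ˣ) (Z : Matrix (Fin g) (Fin g) ℂ) (hZ : Z ∈ siegelUpperHalfSpace g)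
        (P' : PolarizedAbelianSchemeWithLevel g N δ (specOver ℚ ℂ).left), IsAdmissibleAt hδ (rep c) Z hZ P' →
          AlgPoints.map (ιc c) (unif c Z) =
            AlgPoints.baseChangeEquiv (algebraMap ℚ ℂ) 𝓜.M (𝓜.classifyingMap (specOver ℚ ℂ) P'))
    (pts : ComplexPoints ((Literature.AlgebraicGeometry.Motives.baseChange ℚ ℂ).obj 𝓜.M) ≃
      SiegelShimuraSet δ (principalLevelSubgroup δ N))
    (hval : ∀ (c : (ZMod N)ˣ) (W : Matrix (Fin g) (Fin g) ℂ) (hW : W ∈ siegelUpperHalfSpace g),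
      pts (AlgPoints.map (ιc c) (unif c W)) =
        SiegelShimuraSet.mk δ (principalLevelSubgroup δ N)
          ⟨jOfSiegel δ W, C0_subset_C0pm δ (jOfSiegel_mem_C0 hδ.1 hW)⟩ (rep c))
    -- the curve datum (Galois), the frame, E2's complex structure
    {F : Type} [Field F] [NumberField F] [IsCMField F] [IsGalois ℚ F] (ι₁ : F →+* ℂ) (Jstar : Matrix (Fin 2) (Fin 2) F)
    (hJ : (Jstar.map (IsCMField.complexConj F))ᵀ = Jstar) (Φ : CMType F) (hΦ : ι₁ ∈ Φ.1) {ξ : F}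
    (Fr : SymplecticFrameV F (RingHom.id F) Jstar ξ g δ)
    (hJC : ∀ v : Fin 2 → ℂ, v ∈ negCone (Jstar.map ι₁) → auxComplexStructureV Fr ι₁ Φ v ∈ C0pm δ)
    -- the point map, at any level `K`
    (K : Subgroup ↥(finAdelic (↥(maximalRealSubfield F)) F (IsCMField.complexConj F) 2 Jstar))
    (f : ShimuraSetGS F Jstar ι₁ K → ComplexPoints 𝓜.M)
    (hf : ∀ (v : Fin 2 → ℂ) (hv : v ∈ negCone (Jstar.map ι₁)) (a : ↥(finAdelic (↥(maximalRealSubfield F)) F (IsCMField.complexConj F) 2 Jstar)),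
      pts (AlgPoints.baseChangeEquiv (algebraMap ℚ ℂ) 𝓜.M (f (ShimuraSetGS.mk F Jstar ι₁ K v hv a))) =
        SiegelShimuraSet.mk δ (principalLevelSubgroup δ N) ⟨auxComplexStructureV Fr ι₁ Φ v, hJC v hv⟩ (auxToGspFinV Fr (a, 1)))
    -- the point `(σ, s, w, d, a)` with `σ ∈ Aut(ℂ/ι₁F)`
    (σ : ℂ ≃ₐ[ℚ] ℂ) (hσ : ∀ x : F, σ (ι₁ x) = ι₁ x) (s : (FiniteAdeleRing (𝓞 F) F)ˣ) (hs : IsArtinCorrespondent F ι₁ s σ.toRingEquiv)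
    (w : Fin 2 → F) (hw : (fun i => ι₁ (w i)) ∈ negCone (Jstar.map ι₁))
    (d : ↥(finAdelic (↥(maximalRealSubfield F)) F (IsCMField.complexConj F) 2 Jstar)) (hd : IsDiagTwistGS F Jstar w (recipFactor F s) d)
    (a : ↥(finAdelic (↥(maximalRealSubfield F)) F (IsCMField.complexConj F) 2 Jstar)) :
    haveI : NumberField ↥(reflexField F Φ ι₁) := numberField_reflexField F Φ ι₁
    ∃ (c : CMStructure g δ (Fin 2) (fun _ => F)) (Φ' : Fin 2 → CMType F)
      (sE : (FiniteAdeleRing (𝓞 ↥(reflexField F Φ ι₁)) ↥(reflexField F Φ ι₁))ˣ) (t : ↥(torusFinAdelic F))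
      (d' : ↥(finAdelic (↥(maximalRealSubfield F)) F (IsCMField.complexConj F) 2 Jstar)),
      c.IsSpecial ⟨auxComplexStructureV Fr ι₁ Φ (fun i => ι₁ (w i)), hJC _ hw⟩ Φ' ∧
      (∀ x : F, c.actMatrix (fun _ => x) = framePV Fr * resMatrix (ratBasis F) (x • (1 : Matrix (Fin 2) (Fin 2) F)) * frameQV Fr) ∧
      Φ' 0 = Φ ∧ (∀ ρ : F →+* ℂ, ρ ∈ (Φ' 1).1 ↔ (ρ ∈ Φ.1 ∧ ρ ≠ ι₁) ∨ ρ = NumberField.ComplexEmbedding.conjugate ι₁) ∧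
      (∀ i, traceField (Φ' i) ≤ reflexField F Φ ι₁) ∧ (∀ x : ℂ, x ∈ reflexField F Φ ι₁ → σ x = x) ∧
      IsArtinCorrespondent ↥(reflexField F Φ ι₁) (algebraMap ↥(reflexField F Φ ι₁) ℂ) sE σ.toRingEquiv ∧
      ((auxToGspFinV Fr (d', t) : GL (Fin g ⊕ Fin g) finAdeleQ) : Matrix (Fin g ⊕ Fin g) (Fin g ⊕ Fin g) finAdeleQ) =
        c.cmRecipMatrix Φ' (reflexField F Φ ι₁) sE ∧
      (t : (FiniteAdeleRing (𝓞 F) F)ˣ) = reflexNormFiniteIdele F Φ (reflexField F Φ ι₁) sE ∧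
      (∃ s' : (FiniteAdeleRing (𝓞 F) F)ˣ, IsArtinCorrespondent F ι₁ s' σ.toRingEquiv ∧ IsDiagTwistGS F Jstar w (recipFactor F s') d' ∧
        ((reflexNormFiniteIdele F (Φ' 1) (reflexField F Φ ι₁) sE : (FiniteAdeleRing (𝓞 F) F)ˣ) : FiniteAdeleRing (𝓞 F) F) =
          ((t : (FiniteAdeleRing (𝓞 F) F)ˣ) : FiniteAdeleRing (𝓞 F) F) *
            ratFiniteAdeleTensorEquiv F (finAdeleToTensor F (RingHom.id F) (recipFactor F s'))) ∧
      (∀ K' : Subgroup ↥(finAdelic (↥(maximalRealSubfield F)) F (IsCMField.complexConj F) 2 Jstar),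
        ShimuraSetGS.mk F Jstar ι₁ K' (fun i => ι₁ (w i)) hw (d * a) = ShimuraSetGS.mk F Jstar ι₁ K' (fun i => ι₁ (w i)) hw (d' * a)) ∧
      σ • f (ShimuraSetGS.mk F Jstar ι₁ K (fun i => ι₁ (w i)) hw a) =
        (AlgPoints.baseChangeEquiv (algebraMap ℚ ℂ) 𝓜.M).symm
          (pts.symm (SiegelShimuraSet.mk δ (principalLevelSubgroup δ N) ⟨auxComplexStructureV Fr ι₁ Φ (fun i => ι₁ (w i)), hJC _ hw⟩
            (auxToGspFinV Fr (d' * a, 1) * auxToGspFinV Fr (1, t)))) := by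
  classical
  haveI : NumberField ↥(reflexField F Φ ι₁) := numberField_reflexField F Φ ι₁
  -- ★ (S2a) Literature head at `J_Φ` of the curve (special-pair clause discharged by ★ `isSpecial_auxComplexStructureV_curve`)
  obtain ⟨c, Φ', sE, t, d', hsp, hpin, h0, h1, hE, hσE, hsE, hr, ht, hs', hsplit, hGS⟩ :=
    exists_siegelRecipDatum_centralTwist_of_isGalois ι₁ Jstar hJ Φ hΦ Fr (auxComplexStructureV Fr ι₁ Φ) hJC
      (fun w hw b hb1 hperp c hc Φ' h0 h1 => isSpecial_auxComplexStructureV_curve ι₁ Jstar hJ Φ Fr hJC w hw b hb1 hperp c hc Φ' h0 h1)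
      σ hσ s hs w hw d hd a
  refine ⟨c, Φ', sE, t, d', hsp, hpin, h0, h1, hE, hσE, hsE, hr, ht, hs', hGS, ?_⟩
  -- §1 over the split identity `ũ_V(d♯,t)·ũ_V(a,1) = ũ_V(d♯·a,1)·ũ_V(1,t)`
  exact smul_f_mk_eq_symm_mk_of_cmDatum hg hδ hN 𝓜 ιc unif hu huc hmult hD3 pts hval ι₁ Jstar (auxComplexStructureV Fr ι₁ Φ) hJC K
    (fun a' => auxToGspFinV Fr (a', 1)) f hf σ w hw a (d' * a) (reflexField F Φ ι₁) c Φ' sE (auxToGspFinV Fr (d', t))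
    (auxToGspFinV Fr (1, t)) hsp hE hσE hsE hr hsplit

end Summit.HodgeConjecture.HodgeConjecture.Theorems.F0P6aSpecialPairRecipCentralTwistOfChart

end
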